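import Summits.ResolutionOfSingularities.ResolutionOfSingularities.Theorems.WildConesCampaignW46TjurinaNumber
import HarnessLib

/-!
# [OURS · L1 W4.6, rungs (i)/(ii) — the dictionary, SCHEME HALF, brick 19] `τ = p · μ`: the Tjurina number of the
# atom germ `z^p − a(u)` is `p` times the Milnor colength `μ = dim_κ κ⟦u⟧/(∂a)` of route `WildCones`' calculus

Cell res-hironaka (LADDER-RESOLUTION rung L, D-0089), slot W4.6, seat res-L1-s46-pv-2 (gen 4). Host: route
`WildCones`, crux `ClassicalRegimes` (stmt-ResolutionOfSingularities-16884), `--supports … --as helper`.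

HONEST FRAMING. Everything here is OURS and pure commutative algebra over Mathlib (`Submodule.quotientPi`,
`LinearMap.quotKerEquivOfSurjective`, `rank_fun`) and this seat's bricks 3/3b/18. NOTHING here is a statement of
H. Hironaka's manuscript [Hironaka2017]; no FACT-LIST premise. AI review is weaker than expert review.

## What is proved

Let `κ` be a field, `R = κ⟦u₁,…,uₙ⟧`, `S = κ⟦z,u⟧ = MvPowerSeries (Option (Fin n)) κ` (`u`-series placed by
`rename some`, `z = X none`), `a ∈ R` with `a(0) = 0`, `J` an ideal of `R`, `p ≥ 1`, and
`T = (z^p − a) + J·S ⊆ S`.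

* `forall_mem_of_sum_X_pow_mul_rename_mem` — **the `R`-module `S/T` has no relations below degree `p` in `z`**:
  if `∑_{k<p} z^k r_k ∈ T` (`r_k ∈ R`) then every `r_k ∈ J`. Slicing `S ≅ R⟦z⟧` (`optionEquivLeft`) and Krull's
  intersection theorem in `R/J`, as in brick 3's `comap_tjurina_eq` (which is the case `r_1 = ⋯ = r_{p−1} = 0`).
* `maximalIdeal_pow_le_span_sup_map`, `exists_eq_sum_X_pow_mul_rename` — if `𝔪_R^N ≤ J` then `𝔪_S^{pN+N} ≤ T` and
  every class of `S/T` is `∑_{j<p} z^j r_j` (jets + `z^p ≡ a`).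
* `finrank_quotient_span_sup_map_eq_mul` — hence, when `R/J` is finite over `κ`, `S/T ≅ (R/J)^p` `κ`-linearly and
  **`dim_κ S/T = p · dim_κ R/J`**.
* `finrank_tjurina_atom_eq_mul_mu` / `finrank_tjurina_atom_eq_mul_mu'` — for a state `c` of the coefficient calculus
  in characteristic `p`: **`τ(z^p − ser c) = p · μ(c)`**, the Tjurina number of the atom germ (Tjurina ideal
  `(f, ∂f/∂z, ∂f/∂u_k)`, brick 3b `tjurina_eq`) is `p` times `WildCones.mu c = dim_κ κ⟦u⟧/jac c` — unconditionally
  (both sides vanish off `Isol c`, brick 3 `isol_iff_finite_tjurina`).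
* `mu_eq_of_span_eq` — with brick 18 (`finrank_tjurina_eq_of_span_eq`, p530379): two formal presentations
  `E₀(f₀) = w·(z^p − ser c₀)`, `E₀′(f₀′) = w′·(z^p − ser c₀′)` of the same principal ideal of a local ring over a
  perfect field have **the same Milnor number `μ(c₀) = μ(c₀′)`** — the bound `β = μ` of the effective rung
  (`ForcedAtom.finLocalExitBound_forcedAtom`, p524336) is an invariant of the POINT of the forced-atom regime, not of
  the chosen presentation. This closes residue (R4) of this seat's gen-3 census.

References: bricks 3 (p500857), 3b (p501458), 18 (p530379); Greuel–Lossen–Shustin (2007) §I.1–I.2. [GreuelLossenShustin2007] [folklore]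
-/

noncomputable section

-- single-problem summit: the doubled namespace component `ResolutionOfSingularities` is forced
set_option linter.dupNamespace false

open scoped BigOperators Classical
open MvPowerSeries IsLocalRing

namespace Summit.ResolutionOfSingularities.ResolutionOfSingularities.Theorems

namespace CampaignW46.AtomGerm

open WildCones
open Literature.RingTheory.MvPowerSeries (optionEquivLeft coeff_coeff_optionEquivLeft optionEquivLeft_X_none pd)
open Literature.RingTheory.MvPowerSeries.Jets (monomial_mem_maximalIdeal_pow
  maximalIdeal_pow_eq_span_monomial exists_maximalIdeal_pow_le_of_finite_quotient
  mem_maximalIdeal_iff_constantCoeff_eq_zero sub_coe_truncTotal_mem_maximalIdeal_pow)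

variable {n : ℕ} {κ : Type} [Field κ]

/-! ## No relations of `z`-degree `< p`: the kernel -/

/-- [OURS · L1 W4.6] **No relations below degree `p`.** For `a ∈ κ⟦u⟧` with `a(0) = 0`, an ideal `J ⊆ κ⟦u⟧` and
`r_0, …, r_{p−1} ∈ κ⟦u⟧`: if `∑_{k<p} z^k r_k ∈ (z^p − a) + J κ⟦z,u⟧` then every `r_k ∈ J`. (Slice by powers of `z`:
writing the membership as `h·(z^p − a) + j`, the slices of `h` satisfy `h_m ≡ a h_{m+p}` modulo `J`, so lie in
`⋂_N (J + 𝔪^N) = J` by Krull, and `r_k = h_{k−p} − a h_k + j_k ∈ J`.) [folklore] -/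
theorem forall_mem_of_sum_X_pow_mul_rename_mem {a : MvPowerSeries (Fin n) κ} (ha : constantCoeff a = 0)
    (J : Ideal (MvPowerSeries (Fin n) κ)) (p : ℕ) (r : ℕ → MvPowerSeries (Fin n) κ)
    (h : (∑ k ∈ Finset.range p, (X none : MvPowerSeries (Option (Fin n)) κ) ^ k *
        rename (some : Fin n → Option (Fin n)) (r k)) ∈
      Ideal.span {(X none : MvPowerSeries (Option (Fin n)) κ) ^ p - rename (some : Fin n → Option (Fin n)) a} ⊔
        J.map (rename (some : Fin n → Option (Fin n)) : MvPowerSeries (Fin n) κ →ₐ[κ] _)) :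
    ∀ k < p, r k ∈ J := by
  rw [Ideal.mem_span_singleton_sup] at h
  obtain ⟨g, j, hj, hEq⟩ := h
  have hjk := coeff_optionEquivLeft_mem_of_mem_map J hj
  -- apply the slicing isomorphism
  have hEq' : optionEquivLeft g * (PowerSeries.X ^ p - PowerSeries.C a) + optionEquivLeft j =
      ∑ k ∈ Finset.range p, PowerSeries.C (r k) * PowerSeries.X ^ k := by
    have := congrArg optionEquivLeft hEq
    rw [map_add, map_mul, map_sub, map_pow, optionEquivLeft_X_none, optionEquivLeft_rename_some, map_sum] at this
    rw [this]
    refine Finset.sum_congr rfl fun k _ => ?_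
    rw [map_mul, map_pow, optionEquivLeft_X_none, optionEquivLeft_rename_some, mul_comm]
  set H := optionEquivLeft g with hH_def
  set j' := optionEquivLeft j with hj'_def
  -- the `z^m`-slices of the relation
  have hrec : ∀ m, (if p ≤ m then PowerSeries.coeff (m - p) H else 0) - PowerSeries.coeff m H * a +
      PowerSeries.coeff m j' = if m ∈ Finset.range p then r m else 0 := by
    intro m
    have := congrArg (PowerSeries.coeff m) hEq'
    rw [map_add, mul_sub, map_sub, PowerSeries.coeff_mul_X_pow', PowerSeries.coeff_mul_C, map_sum] at this
    rw [this]
    simp_rw [PowerSeries.coeff_C_mul_X_pow]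
    rw [Finset.sum_ite_eq]
  -- one step of the recursion: `H_m ≡ a H_{m+p}` modulo `J`
  have hstep : ∀ m, PowerSeries.coeff m H - a * PowerSeries.coeff (m + p) H ∈ J := by
    intro m
    have h1 := hrec (m + p)
    rw [if_pos (Nat.le_add_left p m), Nat.add_sub_cancel, if_neg (by simp)] at h1
    have h2 : PowerSeries.coeff m H - a * PowerSeries.coeff (m + p) H = -PowerSeries.coeff (m + p) j' := by
      rw [← sub_eq_zero, ← h1]; ring
    rw [h2]
    exact J.neg_mem_iff.2 (hjk (m + p))
  -- iterate: `H_m ≡ a^N H_{m+Np}` modulo `J`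
  have hiter : ∀ N m, PowerSeries.coeff m H - a ^ N * PowerSeries.coeff (m + N * p) H ∈ J := by
    intro N
    induction N with
    | zero => intro m; simp
    | succ N ih =>
      intro m
      have e1 := ih m
      have e2 := hstep (m + N * p)
      have e3 : PowerSeries.coeff m H - a ^ (N + 1) * PowerSeries.coeff (m + (N + 1) * p) H =
          (PowerSeries.coeff m H - a ^ N * PowerSeries.coeff (m + N * p) H) +
            a ^ N * (PowerSeries.coeff (m + N * p) H - a * PowerSeries.coeff (m + N * p + p) H) := by
        rw [show m + (N + 1) * p = m + N * p + p by ring]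
        ring
      rw [e3]
      exact J.add_mem e1 (J.mul_mem_left _ e2)
  -- Krull: every slice of `H` lies in `J`
  have ha𝔪 : a ∈ maximalIdeal (MvPowerSeries (Fin n) κ) := mem_maximalIdeal_iff_constantCoeff_eq_zero.2 ha
  have hH : ∀ m, PowerSeries.coeff m H ∈ J := by
    intro m
    refine mem_of_forall_mem_sup_pow fun N => ?_
    have e : PowerSeries.coeff m H = (PowerSeries.coeff m H - a ^ N * PowerSeries.coeff (m + N * p) H) +
        a ^ N * PowerSeries.coeff (m + N * p) H := by ring
    rw [e]
    exact Submodule.add_mem_sup (hiter N m) (Ideal.mul_mem_right _ _ (Ideal.pow_mem_pow ha𝔪 N))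
  -- the slices `k < p`: `r_k = h_{k−p} − a h_k + j_k ∈ J`
  intro k hk
  have h0 := hrec k
  rw [if_pos (Finset.mem_range.mpr hk)] at h0
  rw [← h0]
  refine J.add_mem (J.sub_mem ?_ (J.mul_mem_right _ (hH k))) (hjk k)
  split_ifs
  · exact hH _
  · exact J.zero_mem

/-! ## Jets: a power of `𝔪_S` lies in `T`, and every class is a polynomial of degree `< p` in `z` -/

/-- A monomial of `κ⟦z,u⟧` is `z^k` times a placed `u`-monomial (with coefficient). [folklore] -/
theorem monomial_eq_X_pow_mul_rename_monomial (e : Option (Fin n) →₀ ℕ) (l : κ) :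
    (monomial e l : MvPowerSeries (Option (Fin n)) κ) =
      X none ^ (e none) * rename (some : Fin n → Option (Fin n)) (monomial e.some l) := by
  have hexp : Finsupp.single none (e none) + Finsupp.mapDomain (some : Fin n → Option (Fin n)) e.some = e := by
    ext o
    cases o with
    | none =>
      rw [Finsupp.add_apply, Finsupp.single_eq_same, Finsupp.mapDomain_notin_range, add_zero]
      simp
    | some j =>
      rw [Finsupp.add_apply, Finsupp.single_eq_of_ne (Option.some_ne_none j), zero_add,
        Finsupp.mapDomain_apply (Option.some_injective _), Finsupp.some_apply]
  rw [rename_monomial, X_pow_eq, monomial_mul_monomial, one_mul, hexp]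

/-- [OURS · L1 W4.6] If `𝔪_R^N ≤ J` then `𝔪_S^{pN+N} ≤ (z^p − a) + J κ⟦z,u⟧` (`a(0) = 0`): a monomial `z^k u^d` of that
degree has `|d| ≥ N` or `k ≥ pN`, and `z^{pN} ≡ a^N ∈ 𝔪_R^N` modulo `z^p − a`. [folklore] -/
theorem maximalIdeal_pow_le_span_sup_map {a : MvPowerSeries (Fin n) κ} (ha : constantCoeff a = 0)
    {J : Ideal (MvPowerSeries (Fin n) κ)} {N : ℕ} (hN : maximalIdeal (MvPowerSeries (Fin n) κ) ^ N ≤ J) (p : ℕ) :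
    maximalIdeal (MvPowerSeries (Option (Fin n)) κ) ^ (p * N + N) ≤
      Ideal.span {(X none : MvPowerSeries (Option (Fin n)) κ) ^ p - rename (some : Fin n → Option (Fin n)) a} ⊔
        J.map (rename (some : Fin n → Option (Fin n)) : MvPowerSeries (Fin n) κ →ₐ[κ] _) := by
  set T := Ideal.span {(X none : MvPowerSeries (Option (Fin n)) κ) ^ p - rename (some : Fin n → Option (Fin n)) a} ⊔
        J.map (rename (some : Fin n → Option (Fin n)) : MvPowerSeries (Fin n) κ →ₐ[κ] _) with hT
  have ha𝔪 : a ∈ maximalIdeal (MvPowerSeries (Fin n) κ) := mem_maximalIdeal_iff_constantCoeff_eq_zero.2 ha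
  -- `z^{pN} ∈ T`
  have hzN : ((X none : MvPowerSeries (Option (Fin n)) κ) ^ p) ^ N ∈ T := by
    rw [← Ideal.Quotient.eq_zero_iff_mem, map_pow]
    have hz : Ideal.Quotient.mk T ((X none : MvPowerSeries (Option (Fin n)) κ) ^ p) =
        Ideal.Quotient.mk T (rename (some : Fin n → Option (Fin n)) a) := by
      rw [Ideal.Quotient.eq]
      exact Ideal.mem_sup_left (Ideal.subset_span rfl)
    rw [hz, ← map_pow, ← map_pow, Ideal.Quotient.eq_zero_iff_mem]
    exact Ideal.mem_sup_right (Ideal.mem_map_of_mem _ (hN (Ideal.pow_mem_pow ha𝔪 N)))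
  rw [maximalIdeal_pow_eq_span_monomial, Ideal.span_le]
  rintro _ ⟨e, he, rfl⟩
  change e.degree = p * N + N at he
  rw [SetLike.mem_coe]
  dsimp only
  rw [monomial_eq_X_pow_mul_rename]
  by_cases hs : N ≤ (e.some).degree
  · exact T.mul_mem_left _ (Ideal.mem_sup_right (Ideal.mem_map_of_mem _
      (hN (monomial_mem_maximalIdeal_pow hs 1))))
  · have hz : p * N ≤ e none := by
      have := degree_eq_none_add_degree_some e
      push Not at hs
      nlinarith
    rw [← Nat.sub_add_cancel hz, pow_add, pow_mul]
    exact T.mul_mem_right _ (T.mul_mem_left _ hzN)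

/-- [OURS · L1 W4.6] **`z^p ≡ a`: reduction of `z`-powers.** In `S/T`, `z^k · g ≡ z^{k mod p} · (a^{⌊k/p⌋} g)` for
`g ∈ κ⟦u⟧`. [folklore] -/
theorem mk_X_pow_mul_rename_eq (a : MvPowerSeries (Fin n) κ) (J : Ideal (MvPowerSeries (Fin n) κ)) (p k : ℕ)
    (g : MvPowerSeries (Fin n) κ) :
    Ideal.Quotient.mk (Ideal.span {(X none : MvPowerSeries (Option (Fin n)) κ) ^ p -
          rename (some : Fin n → Option (Fin n)) a} ⊔
        J.map (rename (some : Fin n → Option (Fin n)) : MvPowerSeries (Fin n) κ →ₐ[κ] _))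
        ((X none : MvPowerSeries (Option (Fin n)) κ) ^ k * rename (some : Fin n → Option (Fin n)) g) =
      Ideal.Quotient.mk (Ideal.span {(X none : MvPowerSeries (Option (Fin n)) κ) ^ p -
          rename (some : Fin n → Option (Fin n)) a} ⊔
        J.map (rename (some : Fin n → Option (Fin n)) : MvPowerSeries (Fin n) κ →ₐ[κ] _))
        ((X none : MvPowerSeries (Option (Fin n)) κ) ^ (k % p) *
          rename (some : Fin n → Option (Fin n)) (a ^ (k / p) * g)) := by
  set T := Ideal.span {(X none : MvPowerSeries (Option (Fin n)) κ) ^ p - rename (some : Fin n → Option (Fin n)) a} ⊔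
        J.map (rename (some : Fin n → Option (Fin n)) : MvPowerSeries (Fin n) κ →ₐ[κ] _) with hT
  have hz : Ideal.Quotient.mk T ((X none : MvPowerSeries (Option (Fin n)) κ) ^ p) =
      Ideal.Quotient.mk T (rename (some : Fin n → Option (Fin n)) a) := by
    rw [Ideal.Quotient.eq]
    exact Ideal.mem_sup_left (Ideal.subset_span rfl)
  have e1 : (X none : MvPowerSeries (Option (Fin n)) κ) ^ k * rename (some : Fin n → Option (Fin n)) g =
      ((X none : MvPowerSeries (Option (Fin n)) κ) ^ p) ^ (k / p) *
        ((X none : MvPowerSeries (Option (Fin n)) κ) ^ (k % p) * rename (some : Fin n → Option (Fin n)) g) := by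
    rw [← pow_mul, ← mul_assoc, ← pow_add, Nat.div_add_mod]
  rw [e1, map_mul, map_pow, hz, ← map_pow, ← map_mul]
  congr 1
  rw [map_mul, map_pow]
  ring

/-- [OURS · L1 W4.6] **Every class of `S/T` is a polynomial of degree `< p` in `z` over `κ⟦u⟧`** (`𝔪_R^N ≤ J`, `a(0) = 0`,
`p ≥ 1`): `x ≡ ∑_{j<p} z^j r_j`. (Jets: `x ≡ truncTotal x` modulo `𝔪_S^{pN+N} ≤ T`; then reduce every monomial by
`z^p ≡ a`.) [folklore] -/
theorem exists_eq_sum_X_pow_mul_rename {a : MvPowerSeries (Fin n) κ} (ha : constantCoeff a = 0)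
    {J : Ideal (MvPowerSeries (Fin n) κ)} {N : ℕ} (hN : maximalIdeal (MvPowerSeries (Fin n) κ) ^ N ≤ J)
    {p : ℕ} (hp : 0 < p) (x : MvPowerSeries (Option (Fin n)) κ) :
    ∃ r : Fin p → MvPowerSeries (Fin n) κ,
      Ideal.Quotient.mk (Ideal.span {(X none : MvPowerSeries (Option (Fin n)) κ) ^ p -
          rename (some : Fin n → Option (Fin n)) a} ⊔
        J.map (rename (some : Fin n → Option (Fin n)) : MvPowerSeries (Fin n) κ →ₐ[κ] _)) x =
      ∑ j : Fin p, Ideal.Quotient.mk (Ideal.span {(X none : MvPowerSeries (Option (Fin n)) κ) ^ p -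
          rename (some : Fin n → Option (Fin n)) a} ⊔
        J.map (rename (some : Fin n → Option (Fin n)) : MvPowerSeries (Fin n) κ →ₐ[κ] _))
        ((X none : MvPowerSeries (Option (Fin n)) κ) ^ (j : ℕ) * rename (some : Fin n → Option (Fin n)) (r j)) := by
  set T := Ideal.span {(X none : MvPowerSeries (Option (Fin n)) κ) ^ p - rename (some : Fin n → Option (Fin n)) a} ⊔
        J.map (rename (some : Fin n → Option (Fin n)) : MvPowerSeries (Fin n) κ →ₐ[κ] _) with hT
  -- truncate
  set P : MvPolynomial (Option (Fin n)) κ := truncTotal (p * N + N) x with hP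
  have hx : Ideal.Quotient.mk T x = Ideal.Quotient.mk T (P : MvPowerSeries (Option (Fin n)) κ) := by
    rw [Ideal.Quotient.eq]
    exact maximalIdeal_pow_le_span_sup_map ha hN p (sub_coe_truncTotal_mem_maximalIdeal_pow _ x)
  -- the truncation as a polynomial in `z` with placed coefficients
  let g : (Option (Fin n) →₀ ℕ) → MvPowerSeries (Fin n) κ := fun e => monomial e.some (P.coeff e)
  have hPsum : (P : MvPowerSeries (Option (Fin n)) κ) =
      ∑ e ∈ P.support, (X none : MvPowerSeries (Option (Fin n)) κ) ^ (e none) *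
        rename (some : Fin n → Option (Fin n)) (g e) := by
    conv_lhs => rw [P.as_sum]
    rw [← MvPolynomial.coeToMvPowerSeries.ringHom_apply, map_sum]
    refine Finset.sum_congr rfl fun e _ => ?_
    rw [MvPolynomial.coeToMvPowerSeries.ringHom_apply, MvPolynomial.coe_monomial, monomial_eq_X_pow_mul_rename_monomial]
  -- the reduced coefficients
  refine ⟨fun j => ∑ e ∈ P.support with e none % p = (j : ℕ), a ^ (e none / p) * g e, ?_⟩
  rw [hx, hPsum, map_sum]
  have hred : ∀ e ∈ P.support, Ideal.Quotient.mk T ((X none : MvPowerSeries (Option (Fin n)) κ) ^ (e none) *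
      rename (some : Fin n → Option (Fin n)) (g e)) =
      Ideal.Quotient.mk T ((X none : MvPowerSeries (Option (Fin n)) κ) ^ (e none % p) *
        rename (some : Fin n → Option (Fin n)) (a ^ (e none / p) * g e)) := fun e _ =>
    mk_X_pow_mul_rename_eq a J p (e none) (g e)
  rw [Finset.sum_congr rfl hred,
    ← Finset.sum_fiberwise_of_maps_to (s := P.support) (t := Finset.range p) (g := fun e => e none % p)
      (fun e _ => Finset.mem_range.mpr (Nat.mod_lt _ hp)),
    Finset.sum_range]
  refine Finset.sum_congr rfl fun j _ => ?_
  rw [map_mul, map_sum, map_sum, Finset.mul_sum]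
  refine Finset.sum_congr rfl fun e he => ?_
  rw [(Finset.mem_filter.mp he).2, map_mul]

/-! ## `dim_κ S/T = p · dim_κ R/J` -/

/-- [OURS · L1 W4.6 — DICTIONARY; NOT a statement of the manuscript] **`S/T ≅ (R/J)^p`, numerically.** For a field `κ`,
`a ∈ κ⟦u⟧` with `a(0) = 0`, an ideal `J` of finite colength and `p ≥ 1`:
`dim_κ κ⟦z,u⟧/((z^p − a) + J) = p · dim_κ κ⟦u⟧/J`. (The `κ`-linear map `(r_j)_{j<p} ↦ ∑ z^j r_j`, `κ⟦u⟧^p → S/T`, is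
onto with kernel `J^{⊕p}`.) [folklore] -/
theorem finrank_quotient_span_sup_map_eq_mul {a : MvPowerSeries (Fin n) κ} (ha : constantCoeff a = 0)
    (J : Ideal (MvPowerSeries (Fin n) κ)) (hJ : Module.Finite κ (MvPowerSeries (Fin n) κ ⧸ J)) {p : ℕ} (hp : 0 < p) :
    Module.finrank κ (MvPowerSeries (Option (Fin n)) κ ⧸
        (Ideal.span {(X none : MvPowerSeries (Option (Fin n)) κ) ^ p - rename (some : Fin n → Option (Fin n)) a} ⊔
          J.map (rename (some : Fin n → Option (Fin n)) : MvPowerSeries (Fin n) κ →ₐ[κ] _))) =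
      p * Module.finrank κ (MvPowerSeries (Fin n) κ ⧸ J) := by
  haveI := hJ
  set T := Ideal.span {(X none : MvPowerSeries (Option (Fin n)) κ) ^ p - rename (some : Fin n → Option (Fin n)) a} ⊔
        J.map (rename (some : Fin n → Option (Fin n)) : MvPowerSeries (Fin n) κ →ₐ[κ] _) with hT
  obtain ⟨N, hN⟩ := exists_maximalIdeal_pow_le_of_finite_quotient J
  -- the comparison map `(r_j) ↦ ∑ z^j r_j`
  let ψ : (Fin p → MvPowerSeries (Fin n) κ) →ₗ[κ] (MvPowerSeries (Option (Fin n)) κ ⧸ T) :=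
    { toFun := fun r => ∑ j : Fin p, Ideal.Quotient.mkₐ κ T
        ((X none : MvPowerSeries (Option (Fin n)) κ) ^ (j : ℕ) * rename (some : Fin n → Option (Fin n)) (r j))
      map_add' := fun r s => by
        simp only [Pi.add_apply, map_add, mul_add, Finset.sum_add_distrib]
      map_smul' := fun l r => by
        simp only [Pi.smul_apply, map_smul, Algebra.mul_smul_comm, RingHom.id_apply, Finset.smul_sum] }
  have hψ : ∀ r, ψ r = ∑ j : Fin p, Ideal.Quotient.mk T
      ((X none : MvPowerSeries (Option (Fin n)) κ) ^ (j : ℕ) * rename (some : Fin n → Option (Fin n)) (r j)) :=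
    fun r => rfl
  -- onto
  have hsurj : Function.Surjective ψ := by
    intro y
    obtain ⟨x, rfl⟩ := Ideal.Quotient.mk_surjective y
    obtain ⟨r, hr⟩ := exists_eq_sum_X_pow_mul_rename ha hN hp x
    exact ⟨r, by rw [hψ, ← hr]⟩
  -- kernel `J^{⊕p}`
  have hker : LinearMap.ker ψ = Submodule.pi Set.univ (fun _ : Fin p => J.restrictScalars κ) := by
    ext r
    rw [LinearMap.mem_ker, Submodule.mem_pi, hψ, ← map_sum, Ideal.Quotient.eq_zero_iff_mem]
    constructor
    · intro h j _
      let r' : ℕ → MvPowerSeries (Fin n) κ := fun k => if hk : k < p then r ⟨k, hk⟩ else 0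
      have hsum : (∑ k ∈ Finset.range p, (X none : MvPowerSeries (Option (Fin n)) κ) ^ k *
          rename (some : Fin n → Option (Fin n)) (r' k)) =
          ∑ j : Fin p, (X none : MvPowerSeries (Option (Fin n)) κ) ^ (j : ℕ) *
            rename (some : Fin n → Option (Fin n)) (r j) := by
        rw [Finset.sum_range]
        refine Finset.sum_congr rfl fun i _ => ?_
        simp only [r', dif_pos i.isLt]
      have hmem := forall_mem_of_sum_X_pow_mul_rename_mem ha J p r' (hsum ▸ h) j j.isLt
      simp only [r', dif_pos j.isLt] at hmem
      exact hmem
    · intro h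
      exact T.sum_mem fun j _ => T.mul_mem_left _
        (Ideal.mem_sup_right (Ideal.mem_map_of_mem _ (h j (Set.mem_univ _))))
  -- assemble the `κ`-linear isomorphism `S/T ≅ (R/J)^p`
  let e₁ : (MvPowerSeries (Option (Fin n)) κ ⧸ T) ≃ₗ[κ] ((Fin p → MvPowerSeries (Fin n) κ) ⧸ LinearMap.ker ψ) :=
    (LinearMap.quotKerEquivOfSurjective ψ hsurj).symm
  let e₂ : ((Fin p → MvPowerSeries (Fin n) κ) ⧸ LinearMap.ker ψ) ≃ₗ[κ]
      ((Fin p → MvPowerSeries (Fin n) κ) ⧸ Submodule.pi Set.univ (fun _ : Fin p => J.restrictScalars κ)) :=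
    Submodule.quotEquivOfEq _ _ hker
  let e₃ : ((Fin p → MvPowerSeries (Fin n) κ) ⧸ Submodule.pi Set.univ (fun _ : Fin p => J.restrictScalars κ)) ≃ₗ[κ]
      ((j : Fin p) → MvPowerSeries (Fin n) κ ⧸ J.restrictScalars κ) :=
    Submodule.quotientPi (fun _ : Fin p => J.restrictScalars κ)
  let e₄ : ((j : Fin p) → MvPowerSeries (Fin n) κ ⧸ J.restrictScalars κ) ≃ₗ[κ]
      (Fin p → MvPowerSeries (Fin n) κ ⧸ J) :=
    LinearEquiv.piCongrRight fun _ => Submodule.Quotient.restrictScalarsEquiv κ J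
  rw [(e₁.trans (e₂.trans (e₃.trans e₄))).finrank_eq, Module.finrank, Module.finrank, rank_fun,
    Cardinal.toNat_mul, Cardinal.toNat_natCast, Fintype.card_fin]

/-! ## The atom: `τ = p · μ` -/

/-- [OURS · L1 W4.6 — DICTIONARY, `τ = p·μ`; replaces the role of «the numerical invariant attached to the singular point
of `z^p = a(u)`» for the atom on the completed local ring (cf. H. Hironaka, ms. 2017, Def. 15.12 p.80 — role only); NOT a
statement of the manuscript] **The Tjurina colength of the atom is `p` times the Milnor colength**: for every state `c`
of route `WildCones`' calculus over a field of characteristic `p`,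
`dim_κ κ⟦z,u⟧/((z^p − ser c) + (jac c)) = p · μ(c)` — unconditionally (both sides are `0` off `Isol c`). [folklore] -/
theorem finrank_tjurina_atom_eq_mul_mu (p : ℕ) [Fact p.Prime] (c : (Fin n → ℕ) → κ) :
    Module.finrank κ (MvPowerSeries (Option (Fin n)) κ ⧸
        (Ideal.span {(X none : MvPowerSeries (Option (Fin n)) κ) ^ p -
            rename (some : Fin n → Option (Fin n)) (ser p n κ c)} ⊔
          (jac p n κ c).map (rename (some : Fin n → Option (Fin n)) : MvPowerSeries (Fin n) κ →ₐ[κ] _))) =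
      p * mu p n κ c := by
  have hp : 0 < p := (Fact.out : p.Prime).pos
  by_cases hI : Isol p n κ c
  · exact finrank_quotient_span_sup_map_eq_mul (constantCoeff_ser c) (jac p n κ c) hI hp
  · have hT := mt (isol_of_finite_tjurina (κ := κ) (p := p) c) hI
    unfold mu
    rw [Module.finrank_of_not_finite hT, Module.finrank_of_not_finite hI, mul_zero]

/-- [OURS · L1 W4.6 — DICTIONARY, `τ = p·μ` with the Tjurina ideal written LITERALLY as `(f) + (∂f/∂x : x ∈ {z,u})` for
`f = z^p − ser c` (tree's `Literature.RingTheory.MvPowerSeries.pd`, characteristic `p`); NOT a statement of the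
manuscript] **`τ(z^p − ser c) = p · μ(c)`.** [folklore] -/
theorem finrank_tjurina_atom_eq_mul_mu' (p : ℕ) [Fact p.Prime] [CharP κ p] (c : (Fin n → ℕ) → κ) :
    Module.finrank κ (MvPowerSeries (Option (Fin n)) κ ⧸
        (Ideal.span {(X none : MvPowerSeries (Option (Fin n)) κ) ^ p -
            rename (some : Fin n → Option (Fin n)) (ser p n κ c)} ⊔
          Ideal.span (Set.range fun o : Option (Fin n) =>
            pd o ((X none : MvPowerSeries (Option (Fin n)) κ) ^ p -
              rename (some : Fin n → Option (Fin n)) (ser p n κ c))))) =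
      p * mu p n κ c := by
  rw [tjurina_eq, ← map_jac_eq]
  exact finrank_tjurina_atom_eq_mul_mu p c

/-! ## The Milnor number does not depend on the presentation -/

/-- [OURS · L1 W4.6 — DICTIONARY, the Milnor number of a point of the forced-atom regime is WELL DEFINED; replaces the role
of «the bound attached to the singular point does not depend on the chosen formal coordinates» (role only); NOT a
statement of the manuscript] Two formal presentations `E₀(f₀) = w·(z^p − ser c₀)`, `E₀′(f₀′) = w′·(z^p − ser c₀′)` (ring
isomorphisms `E₀, E₀′ : S ≃+* K⟦z,u⟧`, units `w, w′`) of the same principal ideal `(f₀) = (f₀′)` of a local ring `R`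
over a perfect field `K` of characteristic `p` have **the same Milnor number**: `μ(c₀) = μ(c₀′)`. (Brick 18: the
Tjurina numbers agree; `τ = p·μ`; cancel `p`.) In particular the bound `β = μ(c₀)` of
`ForcedAtom.finLocalExitBound_forcedAtom` does not depend on the choice made there. [folklore] -/
theorem mu_eq_of_span_eq {p : ℕ} [Fact p.Prime] {K : Type} [Field K] [CharP K p] [PerfectRing K p] {n : ℕ}
    {R S : Type} [CommRing R] [IsLocalRing R] [CommRing S] [Algebra R S]
    (E₀ E₀' : S ≃+* MvPowerSeries (Option (Fin n)) K) (f₀ f₀' : R) (c₀ c₀' : (Fin n → ℕ) → K)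
    (w w' : MvPowerSeries (Option (Fin n)) K) (hJ : Ideal.span {f₀} = Ideal.span {f₀'})
    (hw : IsUnit w) (hw' : IsUnit w')
    (hf₀ : E₀ (algebraMap R S f₀) =
      w * ((X none : MvPowerSeries (Option (Fin n)) K) ^ p -
        rename (some : Fin n → Option (Fin n)) (ser p n K c₀)))
    (hf₀' : E₀' (algebraMap R S f₀') =
      w' * ((X none : MvPowerSeries (Option (Fin n)) K) ^ p -
        rename (some : Fin n → Option (Fin n)) (ser p n K c₀'))) :
    mu p n K c₀ = mu p n K c₀' := by
  have hp : 0 < p := (Fact.out : p.Prime).pos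
  have hτ := finrank_tjurina_eq_of_span_eq E₀ E₀' f₀ f₀' c₀ c₀' w w' hJ hw hw' hf₀ hf₀'
  rw [finrank_tjurina_atom_eq_mul_mu' p c₀, finrank_tjurina_atom_eq_mul_mu' p c₀'] at hτ
  exact (Nat.eq_of_mul_eq_mul_left hp hτ).symm

end CampaignW46.AtomGerm

end Summit.ResolutionOfSingularities.ResolutionOfSingularities.Theorems

end
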